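import Literature.MathematicalPhysics.KineticTheory.HardSphereEulerProofs

/-!
# Lipschitz approximation inside an orthogonality class of one-body observables
(crux stmt-AtomisticToContinuum-14440 `TwoClocks.EquilibriumFastWindowLD`, line `birth`, stub L)

Helper file (`--supports stmt-AtomisticToContinuum-14440`) for the static Lipschitz reduction
`stub_lipschitzReduction` (`W_Lip → W`). Given `θ > 0`, `u ∈ ℝ³`, a finite family of continuous
velocity functions `e_l` with a continuous, compactly supported, Lipschitz, bounded dual family
`ψ_i` under the Maxwellian weight `M = M_{1,u,θ}` (`∫ ψ_i e_l M = δ_{il}`), every continuous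
`G : 𝕋³ × ℝ³ → ℝ` with compact velocity support which is orthogonal at every `x` to all `e_l`
(`∫ G(x,v) e_l(v) M(v) dv = 0`) is, for every `η > 0`, at uniform distance `≤ η` from a continuous
`G'` with compact velocity support, Lipschitz on `𝕋³ × ℝ³` (product metric), and with the same
orthogonality relations:

* `lipschitzReduction_approx`.

Construction: `G` is bounded and uniformly continuous (compact support); the McShane
inf-convolution `g(y) = inf_z (G(z) + K dist(y, z))` is `K`-Lipschitz with `G − ε₁ ≤ g ≤ G` for
`K` large; `G₁ = χ(v) g` with a Lipschitz velocity cutoff restores the compact support; finally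
`G' = G₁ − Σ_i d_i(x) ψ_i(v)` with the defects `d_i(x) = ∫ G₁(x,v) e_i(v) M dv = ∫ (G₁ − G) e_i M`
(small and Lipschitz in `x`) restores the orthogonality exactly. Elementary; no dynamics.
-/

noncomputable section

open MeasureTheory ProbabilityTheory Real Set Filter
open scoped ENNReal BigOperators

namespace Summit.AtomisticToContinuum.HydrodynamicLimit.Theorems.ClampedCorrectorBirth

open Literature.Analysis.FluidPDE Literature.MathematicalPhysics.KineticTheory

/-- **McShane regularisation.** On a pseudometric space, a bounded `f` (`|f| ≤ B`) with modulus
`|f y - f z| ≤ ε` whenever `dist y z < ρ` admits, for `K ρ ≥ 2B`, a `K`-Lipschitz `g` with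
`f - ε ≤ g ≤ f`: `g(y) = inf_z (f z + K dist(y, z))`. [folklore] -/
private theorem exists_lipschitz_approx {X : Type*} [PseudoMetricSpace X] {f : X → ℝ}
    {B K ρ ε : ℝ} (hB : ∀ z, |f z| ≤ B) (hK : 0 ≤ K) (hρ : 2 * B ≤ K * ρ) (hε : 0 ≤ ε)
    (hmod : ∀ y z, dist y z < ρ → |f y - f z| ≤ ε) :
    ∃ g : X → ℝ, (∀ y y', |g y - g y'| ≤ K * dist y y') ∧ (∀ y, g y ≤ f y) ∧
      ∀ y, f y - ε ≤ g y := by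
  have hbdd : ∀ y, BddBelow (Set.range fun z => f z + K * dist y z) := fun y =>
    ⟨-B, by
      rintro _ ⟨z, rfl⟩
      have h := abs_le.1 (hB z)
      nlinarith [dist_nonneg (x := y) (y := z)]⟩
  have key : ∀ y y',
      (⨅ z, (f z + K * dist y z)) ≤ (⨅ z, (f z + K * dist y' z)) + K * dist y y' := by
    intro y y'
    haveI : Nonempty X := ⟨y⟩
    rw [← sub_le_iff_le_add]
    refine le_ciInf fun z => ?_
    rw [sub_le_iff_le_add]
    calc (⨅ z, (f z + K * dist y z)) ≤ f z + K * dist y z := ciInf_le (hbdd y) z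
      _ ≤ f z + K * (dist y' z + dist y y') := by
          have h := mul_le_mul_of_nonneg_left
            (show dist y z ≤ dist y' z + dist y y' by linarith [dist_triangle y y' z]) hK
          linarith
      _ = f z + K * dist y' z + K * dist y y' := by ring
  refine ⟨fun y => ⨅ z, (f z + K * dist y z), fun y y' => ?_, fun y => ?_, fun y => ?_⟩
  · rw [abs_le]
    constructor
    · have h := key y' y
      rw [dist_comm y' y] at h
      linarith
    · linarith [key y y']
  · have h := ciInf_le (hbdd y) y
    simp only [dist_self, mul_zero, add_zero] at h
    exact h
  · haveI : Nonempty X := ⟨y⟩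
    refine le_ciInf fun z => ?_
    rcases lt_or_ge (dist y z) ρ with h | h
    · have h1 := abs_le.1 (hmod y z h)
      nlinarith [dist_nonneg (x := y) (y := z)]
    · have h1 := abs_le.1 (hB y)
      have h2 := abs_le.1 (hB z)
      have h3 : K * ρ ≤ K * dist y z := mul_le_mul_of_nonneg_left h hK
      linarith

/-- The velocity cutoff `χ(v) = max 0 (min 1 (c + 1 - |v|))`: values in `[0, 1]`, `= 1` on the ball
of radius `c`, `= 0` off the ball of radius `c + 1`, and `1`-Lipschitz. [folklore] -/
private theorem cutoff_props (c : ℝ) :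
    (∀ v : V3, 0 ≤ max 0 (min 1 (c + 1 - ‖v‖)) ∧ max 0 (min 1 (c + 1 - ‖v‖)) ≤ 1) ∧
    (∀ v : V3, ‖v‖ ≤ c → max 0 (min 1 (c + 1 - ‖v‖)) = 1) ∧
    (∀ v : V3, c + 1 ≤ ‖v‖ → max 0 (min 1 (c + 1 - ‖v‖)) = 0) ∧
    (∀ v v' : V3,
      |max 0 (min 1 (c + 1 - ‖v‖)) - max 0 (min 1 (c + 1 - ‖v'‖))| ≤ ‖v - v'‖) := by
  refine ⟨fun v => ⟨le_max_left _ _, max_le zero_le_one (min_le_left _ _)⟩, fun v hv => ?_,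
    fun v hv => ?_, fun v v' => ?_⟩
  · rw [min_eq_left (by linarith), max_eq_right zero_le_one]
  · exact max_eq_left ((min_le_right _ _).trans (by linarith))
  · have h1 := abs_max_sub_max_le_max (0 : ℝ) (min 1 (c + 1 - ‖v‖)) 0 (min 1 (c + 1 - ‖v'‖))
    have h2 := abs_min_sub_min_le_max (1 : ℝ) (c + 1 - ‖v‖) 1 (c + 1 - ‖v'‖)
    rw [sub_self, abs_zero,
      max_eq_right (abs_nonneg (min 1 (c + 1 - ‖v‖) - min 1 (c + 1 - ‖v'‖)))] at h1
    rw [sub_self, abs_zero, max_eq_right (abs_nonneg (c + 1 - ‖v‖ - (c + 1 - ‖v'‖)))] at h2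
    have h3 : |c + 1 - ‖v‖ - (c + 1 - ‖v'‖)| = |‖v‖ - ‖v'‖| := by
      rw [show c + 1 - ‖v‖ - (c + 1 - ‖v'‖) = -(‖v‖ - ‖v'‖) by ring, abs_neg]
    rw [h3] at h2
    exact h1.trans (h2.trans (abs_norm_sub_norm_le v v'))

/-- A continuous function on `ℝ³` vanishing off a ball is integrable. [folklore] -/
private theorem integrable_of_vanish {φ : V3 → ℝ} (hφ : Continuous φ) (T : ℝ)
    (hT : ∀ v, T ≤ ‖v‖ → φ v = 0) : Integrable φ :=
  hφ.integrable_of_hasCompactSupport (HasCompactSupport.intro (isCompact_closedBall (0 : V3) T)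
    fun v hv => hT v (by rw [Metric.mem_closedBall, dist_zero_right, not_le] at hv; exact hv.le))

/-- **Lipschitz approximation inside an orthogonality class.** For `θ > 0`, `u ∈ ℝ³`, continuous
`e_l : ℝ³ → ℝ` (`l` in a finite type) with a continuous, compactly supported, Lipschitz, bounded
dual family `ψ_i` under `M_{1,u,θ}`, every continuous `G : 𝕋³ × ℝ³ → ℝ` with compact velocity
support and `∫ G(x,·) e_l M_{1,u,θ} = 0` for all `x, l` is, for every `η > 0`, uniformly
`η`-close to a continuous `G'` with compact velocity support, Lipschitz for the product metric of
`𝕋³ × ℝ³`, and with the same orthogonality relations (McShane regularisation, velocity cutoff,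
exact correction of the defects along the dual family). [folklore] -/
theorem lipschitzReduction_approx :
    ∀ {ι : Type} [Fintype ι] [DecidableEq ι] {θ : ℝ}, 0 < θ → ∀ (u : V3) (e : ι → V3 → ℝ),
    (∀ i, Continuous (e i)) →
    ∀ (ψ : ι → V3 → ℝ), (∀ i, Continuous (ψ i)) →
    (∃ Rψ : ℝ, ∀ v : V3, Rψ ≤ ‖v‖ → ∀ i, ψ i v = 0) →
    (∃ Lψ : ℝ, ∀ i v v', |ψ i v - ψ i v'| ≤ Lψ * ‖v - v'‖) → (∃ Bψ : ℝ, ∀ i v, |ψ i v| ≤ Bψ) →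
    (∀ i l, ∫ v, ψ i v * e l v * localMaxwellian 1 θ u v = if i = l then 1 else 0) →
    ∀ {G : T3 × V3 → ℝ}, Continuous G → (∃ R : ℝ, ∀ y : T3 × V3, R ≤ ‖y.2‖ → G y = 0) →
    (∀ x l, ∫ v, G (x, v) * e l v * localMaxwellian 1 θ u v = 0) →
    ∀ η : ℝ, 0 < η → ∃ G' : T3 × V3 → ℝ, Continuous G' ∧
      (∃ R' : ℝ, ∀ y : T3 × V3, R' ≤ ‖y.2‖ → G' y = 0) ∧
      (∃ L' : ℝ, ∀ y y' : T3 × V3, |G' y - G' y'| ≤ L' * dist y y') ∧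
      (∀ x l, ∫ v, G' (x, v) * e l v * localMaxwellian 1 θ u v = 0) ∧
      ∀ y, |G y - G' y| ≤ η := by
  intro ι _ _ θ hθ u e he ψ hψc hψs hψL hψB hdual G hG hGs hG0 η hη
  set M : V3 → ℝ := localMaxwellian 1 θ u with hM
  have hMc : Continuous M := continuous_localMaxwellian 1 θ u
  have hM0 : ∀ v, 0 ≤ M v := fun v => localMaxwellian_nonneg zero_le_one hθ.le u v
  have hMI : Integrable M := integrable_localMaxwellian hθ u
  have hM1 : ∫ v, M v = 1 := integral_localMaxwellian_one hθ u
  -- the constants of `ψ`, normalised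
  obtain ⟨Rψ, hRψ⟩ := hψs
  obtain ⟨Lψ, hLψ0, hLψ⟩ : ∃ L : ℝ, 0 ≤ L ∧ ∀ i v v', |ψ i v - ψ i v'| ≤ L * ‖v - v'‖ := by
    obtain ⟨L, hL⟩ := hψL
    exact ⟨max L 0, le_max_right _ _, fun i v v' =>
      (hL i v v').trans (mul_le_mul_of_nonneg_right (le_max_left _ _) (norm_nonneg _))⟩
  obtain ⟨Bψ, hBψ0, hBψ⟩ : ∃ B : ℝ, 0 ≤ B ∧ ∀ i v, |ψ i v| ≤ B := by
    obtain ⟨B, hB⟩ := hψB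
    exact ⟨max B 0, le_max_right _ _, fun i v => (hB i v).trans (le_max_left _ _)⟩
  -- the support radius of `G`, normalised
  obtain ⟨S, hS0, hS⟩ : ∃ S : ℝ, 0 ≤ S ∧ ∀ y : T3 × V3, S ≤ ‖y.2‖ → G y = 0 := by
    obtain ⟨R, hR⟩ := hGs
    exact ⟨max R 0, le_max_right _ _, fun y hy => hR y ((le_max_left _ _).trans hy)⟩
  -- the velocity cutoff at radius `S`
  obtain ⟨⟨hχ01, hχ1, hχ0, hχL⟩⟩ := And.intro (cutoff_props S) trivial
  obtain ⟨χ, hχ⟩ : ∃ χ : V3 → ℝ, χ = fun v => max 0 (min 1 (S + 1 - ‖v‖)) := ⟨_, rfl⟩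
  simp only [← show ∀ v, χ v = max 0 (min 1 (S + 1 - ‖v‖)) from fun v => by rw [hχ]]
    at hχ01 hχ1 hχ0 hχL
  have hχc : Continuous χ := by rw [hχ]; fun_prop
  -- a bound of `e` on the ball of radius `S + 1`
  obtain ⟨Be, hBe0, hBe⟩ : ∃ B : ℝ, 0 ≤ B ∧ ∀ i v, ‖v‖ ≤ S + 1 → |e i v| ≤ B := by
    choose C hC using fun i =>
      (isCompact_closedBall (0 : V3) (S + 1)).exists_bound_of_continuousOn (he i).continuousOn
    refine ⟨∑ i, |C i|, Finset.sum_nonneg fun i _ => abs_nonneg _, fun i v hv => ?_⟩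
    have h := hC i v (by rwa [Metric.mem_closedBall, dist_zero_right])
    rw [Real.norm_eq_abs] at h
    exact (h.trans (le_abs_self _)).trans
      (Finset.single_le_sum (f := fun j => |C j|) (fun j _ => abs_nonneg _) (Finset.mem_univ i))
  -- `G` is bounded and uniformly continuous
  have hGK : HasCompactSupport G := by
    refine HasCompactSupport.intro
      ((isCompact_univ (X := T3)).prod (isCompact_closedBall (0 : V3) S)) fun y hy => hS y ?_
    rw [Set.mem_prod, Metric.mem_closedBall, dist_zero_right, not_and] at hy
    exact (not_le.1 (hy (Set.mem_univ _))).le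
  obtain ⟨BG, hBG0, hBG⟩ : ∃ B : ℝ, 0 ≤ B ∧ ∀ y, |G y| ≤ B := by
    obtain ⟨B, hB⟩ := hG.bounded_above_of_compact_support hGK
    exact ⟨max B 0, le_max_right _ _, fun y => (Real.norm_eq_abs _ ▸ hB y).trans (le_max_left _ _)⟩
  have hGu : UniformContinuous G := hGK.uniformContinuous_of_continuous hG
  -- the accuracy `ε₁` of the Lipschitz approximation and the modulus of continuity
  set cι : ℝ := (Fintype.card ι : ℝ) with hcι
  have hden : 0 < 1 + cι * (Be * Bψ) := by positivity
  set ε₁ : ℝ := η / (1 + cι * (Be * Bψ)) with hε₁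
  have hε₁0 : 0 < ε₁ := div_pos hη hden
  have hε₁η : ε₁ * (1 + cι * (Be * Bψ)) = η := div_mul_cancel₀ η hden.ne'
  obtain ⟨ρ, hρ, hmod⟩ := Metric.uniformContinuous_iff.1 hGu ε₁ hε₁0
  -- McShane regularisation at slope `K = 2 B_G / ρ`
  set K : ℝ := 2 * BG / ρ with hK
  have hK0 : 0 ≤ K := by positivity
  obtain ⟨g, hgL, hgle, hgge⟩ := exists_lipschitz_approx (f := G) (K := K) hBG hK0
    (by rw [hK, div_mul_cancel₀ _ hρ.ne']) hε₁0.le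
    (fun y z h => by have h1 := hmod h; rw [Real.dist_eq] at h1; exact h1.le)
  have hgc : Continuous g :=
    (LipschitzWith.of_dist_le' fun y y' => by rw [Real.dist_eq]; exact hgL y y').continuous
  have hgB : ∀ y, |g y| ≤ BG + ε₁ := fun y => by
    have h1 := hgle y; have h2 := hgge y; have h3 := abs_le.1 (hBG y)
    rw [abs_le]; constructor <;> linarith
  -- the cut-off approximation `G₁ = χ g`
  obtain ⟨G₁, hG₁⟩ : ∃ G₁ : T3 × V3 → ℝ, G₁ = fun y => χ y.2 * g y := ⟨_, rfl⟩
  have hG₁c : Continuous G₁ := by rw [hG₁]; fun_prop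
  have hG₁v : ∀ x, Continuous fun v => G₁ (x, v) := fun x =>
    hG₁c.comp (Continuous.prodMk_right x)
  have hG₁s : ∀ y : T3 × V3, S + 1 ≤ ‖y.2‖ → G₁ y = 0 := fun y hy => by
    rw [hG₁]; simp [hχ0 _ hy]
  have hGG₁ : ∀ y, |G y - G₁ y| ≤ ε₁ := by
    intro y
    have h1 := hgle y; have h2 := hgge y
    rw [hG₁]
    simp only
    rcases le_or_gt S ‖y.2‖ with h | h
    · rw [hS y h] at h1 h2 ⊢
      rw [zero_sub, abs_neg, abs_mul, abs_of_nonneg (hχ01 _).1]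
      calc χ y.2 * |g y| ≤ 1 * |g y| := mul_le_mul_of_nonneg_right (hχ01 _).2 (abs_nonneg _)
        _ ≤ ε₁ := by rw [one_mul, abs_le]; constructor <;> linarith
    · rw [hχ1 _ h.le, one_mul, abs_le]
      constructor <;> linarith
  set K₁ : ℝ := BG + ε₁ + K with hK₁
  have hK₁0 : 0 ≤ K₁ := by positivity
  have hG₁L : ∀ y y' : T3 × V3, |G₁ y - G₁ y'| ≤ K₁ * dist y y' := by
    intro y y'
    have hv : ‖y.2 - y'.2‖ ≤ dist y y' := by
      rw [← dist_eq_norm, Prod.dist_eq]; exact le_max_right _ _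
    rw [hG₁]
    calc |χ y.2 * g y - χ y'.2 * g y'| = |(χ y.2 - χ y'.2) * g y + χ y'.2 * (g y - g y')| := by
          ring_nf
      _ ≤ |χ y.2 - χ y'.2| * |g y| + |χ y'.2| * |g y - g y'| := by
          refine (abs_add_le _ _).trans ?_; rw [abs_mul, abs_mul]
      _ ≤ ‖y.2 - y'.2‖ * (BG + ε₁) + 1 * (K * dist y y') :=
          add_le_add (mul_le_mul (hχL _ _) (hgB y) (abs_nonneg _) (norm_nonneg _))
            (mul_le_mul (by rw [abs_of_nonneg (hχ01 _).1]; exact (hχ01 _).2) (hgL y y')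
              (abs_nonneg _) zero_le_one)
      _ ≤ dist y y' * (BG + ε₁) + 1 * (K * dist y y') := by gcongr
      _ = K₁ * dist y y' := by rw [hK₁]; ring
  -- the defects `d_l(x) = ∫ G₁(x,v) e_l(v) M(v) dv`: small and Lipschitz in `x`
  obtain ⟨d, hd⟩ : ∃ d : ι → T3 → ℝ, ∀ l x, d l x = ∫ v, G₁ (x, v) * e l v * M v :=
    ⟨fun l x => ∫ v, G₁ (x, v) * e l v * M v, fun _ _ => rfl⟩
  have hIG₁ : ∀ l x, Integrable (fun v => G₁ (x, v) * e l v * M v) := fun l x =>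
    integrable_of_vanish (((hG₁v x).mul (he l)).mul hMc) (S + 1) fun v hv => by
      rw [hG₁s (x, v) hv, zero_mul, zero_mul]
  have hdB : ∀ l x, |d l x| ≤ ε₁ * Be := by
    intro l x
    have hIG : Integrable (fun v => G (x, v) * e l v * M v) :=
      integrable_of_vanish (((hG.comp (Continuous.prodMk_right x)).mul (he l)).mul hMc) S
        fun v hv => by rw [hS (x, v) hv, zero_mul, zero_mul]
    have e1 : d l x = ∫ v, (G₁ (x, v) - G (x, v)) * e l v * M v := by
      simp_rw [hd, sub_mul]
      rw [integral_sub (hIG₁ l x) hIG, hG0 x l, sub_zero]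
    rw [e1]
    have hpt : ∀ v, ‖(G₁ (x, v) - G (x, v)) * e l v * M v‖ ≤ ε₁ * Be * M v := by
      intro v
      rw [Real.norm_eq_abs, abs_mul, abs_mul, abs_of_nonneg (hM0 v)]
      refine mul_le_mul_of_nonneg_right ?_ (hM0 v)
      rcases le_or_gt ‖v‖ (S + 1) with hv | hv
      · rw [abs_sub_comm]
        exact mul_le_mul (hGG₁ (x, v)) (hBe l v hv) (abs_nonneg _) hε₁0.le
      · rw [hG₁s (x, v) hv.le, hS (x, v) (by simp only; linarith), sub_zero, abs_zero, zero_mul]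
        positivity
    calc |∫ v, (G₁ (x, v) - G (x, v)) * e l v * M v| ≤ ∫ v, ε₁ * Be * M v := by
          rw [← Real.norm_eq_abs]
          exact norm_integral_le_of_norm_le (hMI.const_mul _) (ae_of_all _ hpt)
      _ = ε₁ * Be := by rw [integral_const_mul, hM1, mul_one]
  have hdL : ∀ l x x', |d l x - d l x'| ≤ K₁ * Be * dist x x' := by
    intro l x x'
    rw [hd, hd, ← integral_sub (hIG₁ l x) (hIG₁ l x')]
    have hpt : ∀ v, ‖G₁ (x, v) * e l v * M v - G₁ (x', v) * e l v * M v‖ ≤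
        K₁ * Be * dist x x' * M v := by
      intro v
      rw [← sub_mul, ← sub_mul, Real.norm_eq_abs, abs_mul, abs_mul, abs_of_nonneg (hM0 v)]
      refine mul_le_mul_of_nonneg_right ?_ (hM0 v)
      rcases le_or_gt ‖v‖ (S + 1) with hv | hv
      · have h1 := hG₁L (x, v) (x', v)
        have h2 : dist (x, v) (x', v) = dist x x' := by
          rw [Prod.dist_eq, dist_self]; exact max_eq_left dist_nonneg
        rw [h2] at h1
        calc |G₁ (x, v) - G₁ (x', v)| * |e l v| ≤ K₁ * dist x x' * Be :=
              mul_le_mul h1 (hBe l v hv) (abs_nonneg _) (by positivity)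
          _ = K₁ * Be * dist x x' := by ring
      · rw [hG₁s (x, v) hv.le, hG₁s (x', v) hv.le, sub_self, abs_zero, zero_mul]
        positivity
    calc |∫ v, (G₁ (x, v) * e l v * M v - G₁ (x', v) * e l v * M v)|
        ≤ ∫ v, K₁ * Be * dist x x' * M v := by
          rw [← Real.norm_eq_abs]
          exact norm_integral_le_of_norm_le (hMI.const_mul _) (ae_of_all _ hpt)
      _ = K₁ * Be * dist x x' := by rw [integral_const_mul, hM1, mul_one]
  have hdc : ∀ l, Continuous (d l) := fun l =>
    (LipschitzWith.of_dist_le' fun x x' => by rw [Real.dist_eq]; exact hdL l x x').continuous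
  -- the corrected observable `G' = G₁ - Σ_i d_i(x) ψ_i(v)`
  obtain ⟨G', hG'⟩ : ∃ G' : T3 × V3 → ℝ, G' = fun y => G₁ y - ∑ i, d i y.1 * ψ i y.2 :=
    ⟨_, rfl⟩
  refine ⟨G', ?_, ⟨max (S + 1) Rψ, fun y hy => ?_⟩,
    ⟨K₁ + cι * (K₁ * Be * Bψ + ε₁ * Be * Lψ), fun y y' => ?_⟩, fun x l => ?_, fun y => ?_⟩
  · -- continuity
    rw [hG']
    refine hG₁c.sub (continuous_finsetSum _ fun i _ => ?_)
    exact ((hdc i).comp continuous_fst).mul ((hψc i).comp continuous_snd)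
  · -- compact velocity support
    rw [hG']
    simp only
    rw [hG₁s y (le_of_max_le_left hy)]
    simp [hRψ y.2 (le_of_max_le_right hy)]
  · -- Lipschitz bound for the product metric
    rw [hG']
    have hx : dist y.1 y'.1 ≤ dist y y' := by rw [Prod.dist_eq]; exact le_max_left _ _
    have hv : ‖y.2 - y'.2‖ ≤ dist y y' := by
      rw [← dist_eq_norm, Prod.dist_eq]; exact le_max_right _ _
    have hterm : ∀ i, |d i y.1 * ψ i y.2 - d i y'.1 * ψ i y'.2| ≤
        (K₁ * Be * Bψ + ε₁ * Be * Lψ) * dist y y' := by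
      intro i
      calc |d i y.1 * ψ i y.2 - d i y'.1 * ψ i y'.2|
          = |(d i y.1 - d i y'.1) * ψ i y.2 + d i y'.1 * (ψ i y.2 - ψ i y'.2)| := by ring_nf
        _ ≤ |d i y.1 - d i y'.1| * |ψ i y.2| + |d i y'.1| * |ψ i y.2 - ψ i y'.2| := by
            refine (abs_add_le _ _).trans ?_; rw [abs_mul, abs_mul]
        _ ≤ K₁ * Be * dist y.1 y'.1 * Bψ + ε₁ * Be * (Lψ * ‖y.2 - y'.2‖) :=
            add_le_add (mul_le_mul (hdL i _ _) (hBψ i _) (abs_nonneg _) (by positivity))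
              (mul_le_mul (hdB i _) (hLψ i _ _) (abs_nonneg _) (by positivity))
        _ ≤ K₁ * Be * dist y y' * Bψ + ε₁ * Be * (Lψ * dist y y') := by gcongr
        _ = (K₁ * Be * Bψ + ε₁ * Be * Lψ) * dist y y' := by ring
    calc |G₁ y - ∑ i, d i y.1 * ψ i y.2 - (G₁ y' - ∑ i, d i y'.1 * ψ i y'.2)|
        = |(G₁ y - G₁ y') - ∑ i, (d i y.1 * ψ i y.2 - d i y'.1 * ψ i y'.2)| := by
          rw [Finset.sum_sub_distrib]; congr 1; ring
      _ ≤ |G₁ y - G₁ y'| + |∑ i, (d i y.1 * ψ i y.2 - d i y'.1 * ψ i y'.2)| := abs_sub _ _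
      _ ≤ K₁ * dist y y' + ∑ i, |d i y.1 * ψ i y.2 - d i y'.1 * ψ i y'.2| :=
          add_le_add (hG₁L y y') (Finset.abs_sum_le_sum_abs _ _)
      _ ≤ K₁ * dist y y' + ∑ i, (K₁ * Be * Bψ + ε₁ * Be * Lψ) * dist y y' :=
          add_le_add le_rfl (Finset.sum_le_sum fun i _ => hterm i)
      _ = (K₁ + cι * (K₁ * Be * Bψ + ε₁ * Be * Lψ)) * dist y y' := by
          rw [Finset.sum_const, Finset.card_univ, nsmul_eq_mul, hcι]; ring
  · -- orthogonality
    rw [hG']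
    have hIψ : ∀ i, Integrable (fun v => ψ i v * e l v * M v) := fun i =>
      integrable_of_vanish (((hψc i).mul (he l)).mul hMc) Rψ fun v hv => by
        rw [hRψ v hv i, zero_mul, zero_mul]
    have e1 : (fun v => (G₁ (x, v) - ∑ i, d i x * ψ i v) * e l v * M v) =
        fun v => G₁ (x, v) * e l v * M v - ∑ i, d i x * (ψ i v * e l v * M v) := by
      funext v
      rw [sub_mul, sub_mul, Finset.sum_mul, Finset.sum_mul]
      congr 1
      exact Finset.sum_congr rfl fun i _ => by ring
    simp only
    rw [e1, integral_sub (hIG₁ l x) (integrable_finsetSum _ fun i _ => (hIψ i).const_mul _),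
      integral_finsetSum _ fun i _ => (hIψ i).const_mul _]
    simp_rw [integral_const_mul, hdual, ← hd]
    simp [Finset.sum_ite_eq']
  · -- approximation
    rw [hG']
    calc |G y - (G₁ y - ∑ i, d i y.1 * ψ i y.2)| = |(G y - G₁ y) + ∑ i, d i y.1 * ψ i y.2| := by
          congr 1; ring
      _ ≤ |G y - G₁ y| + |∑ i, d i y.1 * ψ i y.2| := abs_add_le _ _
      _ ≤ ε₁ + ∑ i, |d i y.1 * ψ i y.2| := add_le_add (hGG₁ y) (Finset.abs_sum_le_sum_abs _ _)
      _ ≤ ε₁ + ∑ i, ε₁ * Be * Bψ :=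
          add_le_add le_rfl (Finset.sum_le_sum fun i _ => by
            rw [abs_mul]; exact mul_le_mul (hdB i _) (hBψ i _) (abs_nonneg _) (by positivity))
      _ = ε₁ * (1 + cι * (Be * Bψ)) := by
          rw [Finset.sum_const, Finset.card_univ, nsmul_eq_mul, hcι]; ring
      _ = η := hε₁η

end Summit.AtomisticToContinuum.HydrodynamicLimit.Theorems.ClampedCorrectorBirth

end
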